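import Summits.CriticalPhenomena.CardyFormulaZ2.Theorems.CardyFlipRussoCoveringLegStubFrameBridgeTransport
import Summits.CriticalPhenomena.CardyFormulaZ2.Theorems.CardyFlipRussoCoveringLegShiftDefs
import HarnessLib

/-!
# Stub `stub_frameBridgeShift` of line `five-arm-null` (v3, shifted family) for the crux `CardyFlipRusso.CoveringLeg`

Route `CardyFlipRusso`, sub-problem `CriticalPhenomena/CardyFormulaZ2`, crux item stmt-CriticalPhenomena-6435
(`Summit.CriticalPhenomena.CardyFormulaZ2.Theses.CardyFlipRusso.CoveringLeg`), skeleton v3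
`Cruxes/CoveringLeg/Lines/five_arm_null.lean` (lead `prover-line-stmt-CriticalPhenomena-6435-c1-0`).

THE FRAME BRIDGE IS EXACT FOR THE SHIFTED FAMILY.  Route CardySectorGap's covering-adapted embedding of `G_s` is
`z' = ρ·z + i/√2` (`ρ = (1 − i)/√2`, `frame_zS_eq`), i.e. frame A rotated by `−π/4` AND translated by the
non-period vector `i/√2`; lead a1 showed (`frame_lawP_half_crossS`, p118173) that the frame-B crude crossing
probability of `R` at `q = ½` is the frame-A one of `ρ⁻¹R + δ·w₀`, `w₀ = (1 − i)/2`, so that `CardyCentredSquare`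
(stmt-7048) is Cardy for a half-cell–SHIFTED discretisation.  For the translated rectangle `R ⊕ δc`,
`c = i/√2`, the two shifts cancel exactly: `ρ⁻¹ c = (i − 1)/2 = −w₀` (`shift_rotInv_mul_shiftVec_add`), hence
`(lawP ½).real (crossS (R ⊕ δ c) δ) = siteProb (ρ⁻¹ R) δ` (`shift_lawP_half_crossS`) and Cardy for the frame-A
family (`SiteCardy`, the crux hypothesis, applied to `ρ⁻¹R`) IS Cardy for the `q = ½` crossing probabilities of the
shifted family (`stub_frameBridgeShift`), by similarity covariance of `HasCrossingLimit`
(`frame_hasCrossingLimit_of_map_similarity`).  No percolation estimate is involved.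

References: V. Beffara, *Is critical 2D percolation universal?*, Progr. Probab. 60 (2008) §5.1 [Beffara2008Universal];
W. Werner, *Lectures on two-dimensional critical percolation* (2009) §3.2 (similarity covariance).
-/

noncomputable section

namespace Summit.CriticalPhenomena.CardyFormulaZ2.Cruxes.CoveringLeg.FiveArmNull

open Filter Set Topology
open Literature.Probability.RandomPlanarGeometry Literature.Probability.Percolation
open Literature.Probability.LatticeModels
open Literature.Barriers.CriticalPhenomena (MixedSite mixedParam)
open Summit.CriticalPhenomena.CardyFormulaZ2.Theses

/-- The shift vector `c = i/√2` cancels a1's residual half-cell shift after the back-rotation: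
`ρ⁻¹·(δ c) + δ w₀ = 0` with `ρ⁻¹ = (1 + i)/√2`, `w₀ = (1 − i)/2`. [cite: Beffara2008Universal, §5.1] -/
theorem shift_rotInv_mul_shiftVec_add (δ : ℝ) :
    (1 + Complex.I) / (Real.sqrt 2 : ℂ) * ((δ : ℂ) * (Complex.I / (Real.sqrt 2 : ℂ))) +
      (δ : ℂ) * ((1 - Complex.I) / 2) = 0 := by
  have hs2 : ((Real.sqrt 2 : ℂ))⁻¹ * ((Real.sqrt 2 : ℂ))⁻¹ = 1 / 2 := by
    rw [← mul_inv, ← Complex.ofReal_mul, Real.mul_self_sqrt zero_le_two]; norm_num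
  simp only [div_eq_mul_inv]
  linear_combination (δ : ℂ) * (1 + Complex.I) * Complex.I * hs2 + (δ : ℂ) * 2⁻¹ * Complex.I_sq

/-- Translating by `δ c` and then rotating back by `ρ⁻¹` and translating by `δ w₀` is the pure back-rotation
`p ↦ ρ⁻¹ p`. [folklore] -/
theorem shift_translate_trans_rotInv_trans_shift (δ : ℝ) :
    (similarity 1 one_ne_zero ((δ : ℂ) * (Complex.I / (Real.sqrt 2 : ℂ)))).trans
        ((similarity ((1 + Complex.I) / (Real.sqrt 2 : ℂ)) frame_rotInv_ne_zero 0).trans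
          (similarity 1 one_ne_zero ((δ : ℂ) * ((1 - Complex.I) / 2)))) =
      similarity ((1 + Complex.I) / (Real.sqrt 2 : ℂ)) frame_rotInv_ne_zero 0 :=
  Homeomorph.ext fun p => by
    simp only [Homeomorph.trans_apply, similarity_apply, one_mul, add_zero]
    rw [mul_add, add_assoc, shift_rotInv_mul_shiftVec_add, add_zero]

/-- **The dictionary for the shifted family (exact).**  For every conformal rectangle `R` and mesh `δ`, the frame-B
crude crossing probability at `q = ½` of the translate `R ⊕ δ·i/√2` EQUALS the frame-A crude crossing probability
`siteProb` (the crux's family) of the back-rotated rectangle `ρ⁻¹ R` at the same mesh — no residual shift.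
[cite: Beffara2008Universal, §5.1] -/
theorem shift_lawP_half_crossS (R : ConformalRectangle) (δ : ℝ) :
    (lawP half).real (crossS (R.map (similarity 1 one_ne_zero ((δ : ℂ) * (Complex.I / (Real.sqrt 2 : ℂ))))) δ) =
      siteProb (R.map (similarity ((1 + Complex.I) / (Real.sqrt 2 : ℂ)) frame_rotInv_ne_zero 0)) δ := by
  rw [frame_lawP_half_crossS, MarkedDomain.map_map, MarkedDomain.map_map, shift_translate_trans_rotInv_trans_shift]

/-- **S1' in expanded form**: Cardy for crude site-`G_s` crossings in the crux's frame A (`SiteCardy`) implies Cardy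
for the frame-B crude crossing probabilities at `q = ½` of the shifted family `R ⊕ δ·i/√2` (`CardyHalfShift`): by
`shift_lawP_half_crossS` that family is `siteProb (ρ⁻¹R)`, whose Cardy limit for `R`'s uniformizing data is
`SiteCardy (ρ⁻¹R)` transported along the similarity (`frame_hasCrossingLimit_of_map_similarity`).
[cite: Beffara2008Universal, §5.1] -/
theorem cardyHalfShift_of_siteCardy (hSite : SiteCardy) : CardyHalfShift := by
  intro R
  simp only [shift_lawP_half_crossS]
  exact frame_hasCrossingLimit_of_map_similarity R _ frame_rotInv_ne_zero 0
    (hSite (R.map (similarity ((1 + Complex.I) / (Real.sqrt 2 : ℂ)) frame_rotInv_ne_zero 0)))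

/-- **Registered stub `stub_frameBridgeShift` (S1' of skeleton v3) — PROVED, exact** (no percolation estimate:
rigid transport only). [cite: Beffara2008Universal, §5.1] -/
theorem stub_frameBridgeShift :
    Summit.CriticalPhenomena.CardyFormulaZ2.Cruxes.CoveringLeg.FiveArmNull.Sig.stub_frameBridgeShift :=
  fun hSite => cardyHalfShift_of_siteCardy hSite

end Summit.CriticalPhenomena.CardyFormulaZ2.Cruxes.CoveringLeg.FiveArmNull

end
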